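import Mathlib

/-!
# Disc certificates for complex roots of integer polynomials (venture `DiscreteObjects`, target L)

Cell `pub-namedobj`, seat `pub-namedobj-mahler` (gen 11). Framing: lottery ticket; floor = certified
bounds/negative ranges.

A Newton–Kantorovich-type ROOT CERTIFICATE in the kernel, from rational data: for `Q ∈ ℤ[X]`, a Gaussian rational
centre `c`, a radius `ρ`, and rational bounds `‖Q(c)‖ ≤ η`, `‖Q'(c)‖ ≥ μ`, `Σ_k |Q''_k| R^k ≤ L̄` on `‖z‖ ≤ R ⊇` the
disc, with `L̄ρ ≤ κμ`, `κ < 1`, `η ≤ (1 - κ)ρμ`, the simplified Newton map `z ↦ z - Q(z)/Q'(c)` is a `κ`-contraction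
of the closed disc `‖z - c‖ ≤ ρ` (mean value inequality), so (Banach) `Q` has a root in the disc.  Used by the trace
certificates with TWO complex-conjugate pairs of trace roots (`TraceDiscCertificate`: census core `c16_14` and the
`ν ≥ 4` rows `D = 32, 42, 44, 48, 52, 54` of MRW08 Table 1), where the cofactor trick of `TraceNu2Structure` no
longer separates the pairs.

* `mk_mul_mk` — product of complex literals (lets `norm_num` evaluate `Q` at a Gaussian rational componentwise);
* `norm_aeval_le_sum` — `‖Q(z)‖ ≤ Σ_k |q_k| R^k` for `‖z‖ ≤ R`;
* `exists_root_near` — the certificate.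
-/

namespace Summit.Ventures.DiscreteObjects.Mahler

open Polynomial

/-- Product of complex literals, componentwise (for `norm_num` evaluation at Gaussian rationals). -/
theorem mk_mul_mk (a b c d : ℝ) : (⟨a, b⟩ : ℂ) * ⟨c, d⟩ = ⟨a * c - b * d, a * d + b * c⟩ := by
  apply Complex.ext <;> simp

/-- `‖Q(z)‖ ≤ Σ_{k<n} |q_k| R^k` for `‖z‖ ≤ R` and `deg Q < n`. -/
theorem norm_aeval_le_sum (P : ℤ[X]) {n : ℕ} (hn : P.natDegree < n) {z : ℂ} {R : ℝ} (hz : ‖z‖ ≤ R) :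
    ‖aeval z P‖ ≤ ∑ k ∈ Finset.range n, |(P.coeff k : ℝ)| * R ^ k := by
  rw [aeval_eq_sum_range' hn]
  refine (norm_sum_le _ _).trans (Finset.sum_le_sum fun k _ => ?_)
  rw [zsmul_eq_mul, norm_mul, norm_pow, Complex.norm_intCast]
  exact mul_le_mul_of_nonneg_left (pow_le_pow_left₀ (norm_nonneg _) hz k) (abs_nonneg _)

/-- **Root certificate (simplified Newton map + Banach).**  `Q ∈ ℤ[X]`, centre `c`, radius `ρ > 0`; if
`|c| ≤ R - ρ`, `‖Q(c)‖ ≤ η`, `μ ≤ ‖Q'(c)‖` (`μ > 0`), `Σ_{k ≤ deg Q} |Q''_k| R^k ≤ L̄`, `L̄ρ ≤ κμ`, `0 ≤ κ < 1` and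
`η ≤ (1 - κ)ρμ`, then `Q` has a complex root `z` with `‖z - c‖ ≤ ρ`.  (Norms enter squared, via `Complex.normSq`,
so that every hypothesis is a rational computation.) -/
theorem exists_root_near (Q : ℤ[X]) (c : ℂ) {ρ R η μ Lbar κ : ℝ} (hρ : 0 < ρ)
    (hR : Complex.normSq c ≤ (R - ρ) ^ 2) (hRρ : ρ ≤ R)
    (hη : Complex.normSq (aeval c Q) ≤ η ^ 2) (hη0 : 0 ≤ η)
    (hμ : μ ^ 2 ≤ Complex.normSq (aeval c (derivative Q))) (hμ0 : 0 < μ)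
    (hL : ∑ k ∈ Finset.range (Q.natDegree + 1), |((derivative (derivative Q)).coeff k : ℝ)| * R ^ k ≤ Lbar)
    (hκ : Lbar * ρ ≤ κ * μ) (hκ0 : 0 ≤ κ) (hκ1 : κ < 1) (hclose : η ≤ (1 - κ) * ρ * μ) :
    ∃ z : ℂ, ‖z - c‖ ≤ ρ ∧ aeval z Q = 0 := by
  set F₁ : ℂ := aeval c (derivative Q) with hF₁def
  have hF₁ : μ ≤ ‖F₁‖ :=
    le_of_pow_le_pow_left₀ two_ne_zero (norm_nonneg _) (by rwa [Complex.sq_norm])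
  have hF₁pos : 0 < ‖F₁‖ := lt_of_lt_of_le hμ0 hF₁
  have hF₁0 : F₁ ≠ 0 := norm_pos_iff.mp hF₁pos
  have hFc : ‖aeval c Q‖ ≤ η := le_of_pow_le_pow_left₀ two_ne_zero hη0 (by rwa [Complex.sq_norm])
  have hc : ‖c‖ ≤ R - ρ := le_of_pow_le_pow_left₀ two_ne_zero (by linarith) (by rwa [Complex.sq_norm])
  have hLbar0 : 0 ≤ Lbar :=
    le_trans (Finset.sum_nonneg fun k _ => mul_nonneg (abs_nonneg _) (pow_nonneg (by linarith) _)) hL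
  set B : Set ℂ := Metric.closedBall c ρ with hB
  have hBR : ∀ z ∈ B, ‖z‖ ≤ R := by
    intro z hz
    have h1 : ‖z - c‖ ≤ ρ := mem_closedBall_iff_norm.mp hz
    calc ‖z‖ = ‖(z - c) + c‖ := by rw [sub_add_cancel]
      _ ≤ ‖z - c‖ + ‖c‖ := norm_add_le _ _
      _ ≤ R := by linarith
  -- `Q''` is bounded by `L̄` on the disc
  have hdeg2 : (derivative (derivative Q)).natDegree < Q.natDegree + 1 :=
    lt_of_le_of_lt ((natDegree_derivative_le _).trans ((Nat.sub_le _ _).trans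
      ((natDegree_derivative_le _).trans (Nat.sub_le _ _)))) (Nat.lt_succ_self _)
  have hF'' : ∀ z ∈ B, ‖aeval z (derivative (derivative Q))‖ ≤ Lbar := fun z hz =>
    (norm_aeval_le_sum _ hdeg2 (hBR z hz)).trans hL
  -- polynomial functions and their derivatives
  have hfun : ∀ P : ℤ[X], (fun z : ℂ => aeval z P) = fun z => (P.map (algebraMap ℤ ℂ)).eval z := by
    intro P; ext z; rw [aeval_def, eval_map]
  have hdiff : ∀ P : ℤ[X], ∀ z : ℂ, DifferentiableAt ℂ (fun z : ℂ => aeval z P) z := by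
    intro P z; rw [hfun]; exact Polynomial.differentiableAt _
  have hderiv : ∀ P : ℤ[X], ∀ z : ℂ, deriv (fun z : ℂ => aeval z P) z = aeval z (derivative P) := by
    intro P z; rw [hfun P, Polynomial.deriv, Polynomial.derivative_map, eval_map, aeval_def]
  -- `‖Q'(z) - Q'(c)‖ ≤ L̄ ‖z - c‖` on the disc
  have hd1 : ∀ z ∈ B, ‖aeval z (derivative Q) - F₁‖ ≤ Lbar * ‖z - c‖ := by
    intro z hz
    exact (convex_closedBall c ρ).norm_image_sub_le_of_norm_deriv_le (f := fun z : ℂ => aeval z (derivative Q))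
      (fun x _ => hdiff _ x) (fun x hx => by rw [hderiv]; exact hF'' x hx) (Metric.mem_closedBall_self hρ.le) hz
  -- `g(z) = Q(z) - Q'(c) z` is `L̄ρ`-Lipschitz on the disc
  set g : ℂ → ℂ := fun z => aeval z Q - F₁ * z with hgdef
  have hgd : ∀ z : ℂ, HasDerivAt g (aeval z (derivative Q) - F₁) z := by
    intro z
    have h := ((hdiff Q z).hasDerivAt.sub ((hasDerivAt_id' z).const_mul F₁))
    rw [hderiv, mul_one] at h
    exact h
  have hgdiff : ∀ z : ℂ, DifferentiableAt ℂ g z := fun z => (hgd z).differentiableAt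
  have hgderiv : ∀ z : ℂ, deriv g z = aeval z (derivative Q) - F₁ := fun z => (hgd z).deriv
  have hg : ∀ z ∈ B, ∀ w ∈ B, ‖g z - g w‖ ≤ Lbar * ρ * ‖z - w‖ := by
    intro z hz w hw
    refine (convex_closedBall c ρ).norm_image_sub_le_of_norm_deriv_le (f := g) (fun x _ => hgdiff x)
      (fun x hx => ?_) hw hz
    rw [hgderiv]
    calc ‖aeval x (derivative Q) - F₁‖ ≤ Lbar * ‖x - c‖ := hd1 x hx
      _ ≤ Lbar * ρ := mul_le_mul_of_nonneg_left (mem_closedBall_iff_norm.mp hx) hLbar0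
  -- the simplified Newton map
  set Φ : ℂ → ℂ := fun z => z - aeval z Q / F₁ with hΦdef
  have hΦ : ∀ z w, Φ z - Φ w = -(g z - g w) / F₁ := by
    intro z w; rw [hΦdef, hgdef]; field_simp; ring
  have hΦlip : ∀ z ∈ B, ∀ w ∈ B, ‖Φ z - Φ w‖ ≤ κ * ‖z - w‖ := by
    intro z hz w hw
    rw [hΦ, norm_div, norm_neg]
    calc ‖g z - g w‖ / ‖F₁‖ ≤ Lbar * ρ * ‖z - w‖ / μ := div_le_div₀ (by positivity) (hg z hz w hw) hμ0 hF₁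
      _ = Lbar * ρ / μ * ‖z - w‖ := by ring
      _ ≤ κ * ‖z - w‖ := mul_le_mul_of_nonneg_right ((div_le_iff₀ hμ0).mpr hκ) (norm_nonneg _)
  have hΦc : ‖Φ c - c‖ ≤ (1 - κ) * ρ := by
    have : Φ c - c = -(aeval c Q) / F₁ := by rw [hΦdef]; ring
    rw [this, norm_div, norm_neg]
    calc ‖aeval c Q‖ / ‖F₁‖ ≤ η / μ := div_le_div₀ hη0 hFc hμ0 hF₁
      _ ≤ (1 - κ) * ρ := (div_le_iff₀ hμ0).mpr hclose
  have hmaps : Set.MapsTo Φ B B := by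
    intro z hz
    rw [hB, mem_closedBall_iff_norm]
    calc ‖Φ z - c‖ = ‖(Φ z - Φ c) + (Φ c - c)‖ := by rw [sub_add_sub_cancel]
      _ ≤ ‖Φ z - Φ c‖ + ‖Φ c - c‖ := norm_add_le _ _
      _ ≤ κ * ‖z - c‖ + (1 - κ) * ρ := add_le_add (hΦlip z hz c (Metric.mem_closedBall_self hρ.le)) hΦc
      _ ≤ κ * ρ + (1 - κ) * ρ := by
          have := mem_closedBall_iff_norm.mp hz; nlinarith
      _ = ρ := by ring
  -- Banach
  have hlip : LipschitzOnWith ⟨κ, hκ0⟩ Φ B :=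
    LipschitzOnWith.of_dist_le_mul fun z hz w hw => by
      rw [dist_eq_norm, dist_eq_norm]; exact hΦlip z hz w hw
  have hK : ContractingWith ⟨κ, hκ0⟩ (hmaps.restrict Φ B B) := by
    refine ⟨?_, hlip.mapsToRestrict hmaps⟩
    rw [← NNReal.coe_lt_coe, NNReal.coe_one]; exact hκ1
  obtain ⟨z, hzB, hfix, -⟩ := ContractingWith.exists_fixedPoint' Metric.isClosed_closedBall.isComplete hmaps hK
    (Metric.mem_closedBall_self hρ.le) (edist_ne_top _ _)
  refine ⟨z, mem_closedBall_iff_norm.mp hzB, ?_⟩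
  have h1 : z - aeval z Q / F₁ = z := hfix
  have h2 : aeval z Q / F₁ = 0 := by linear_combination -h1
  rcases div_eq_zero_iff.mp h2 with h | h
  · exact h
  · exact absurd h hF₁0

end Summit.Ventures.DiscreteObjects.Mahler
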